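import Summits.QuantumFields.BalabanUV.Beta.FP.PerfectColumnUniform
import Summits.QuantumFields.BalabanUV.Beta.GAN24.AliasClassSum

/-!
# `BalabanUV.Beta.FP.PerfectColumnMassFibre` — road «FP» for binder row D1, row **N7/IPROF-UNIF**, route (γ) part 1: THE BOX-SUMMED (U2) OF THE FIELD–MULTIPLIER
# QUARTER — summed over the `L^4 = (Lc^m)^4` box representatives of the reading leg, the squared fibre function of the perfect minimiser column is
# `≤ A²·e^{8η}·6⁵·5⁴·((Lc^m)^6)⁻¹` (vs `((Lc^m)^2)⁻¹` for ONE representative, p229339 §1), hence `Σ_{zx} ‖kFibΔM … (repZ zx) …‖ ≤ (5 + 2·aR 4)·e^{4κ}·5400·(Lc^m)⁻¹`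
# on ONE strip for every `m`, `j` — the SAME constant as the single-representative bound, now for the whole box

NOT IN PRINT; OUR BOOKKEEPING over road P1's fibre theorems re-read BY NAME.  HONEST FRAMING (cell contract, verbatim): «discharging `BetaPertH` makes Bałaban's UV
stability UNCONDITIONAL — a real constructive-QFT result; it is NOT the continuum limit and NOT the Clay problem.»  HONEST DEPENDENCY (verbatim): «continuum YM on T⁴ ⇐
BetaPertH ∧ nine spine estimates (0/9 proved); BetaPertH ⇐ (D1) ∧ (D4) ∧ CAP+tail; G-an2-4 gates asym, D1 and NE2/3/4.»  THIS MODULE DISCHARGES NOTHING of N7 ∕ `hasym` ∕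
H4-ASM ∕ row D1: it is the fibre half of route (γ) of the located residual of row IPROF-UNIF (owner d1-p3's `HOME/b2b-balaban-beta-d1-p3/LEAVES-FP.md`; cross-lane filing
by an idle G-an2-4 swarm seat, unit `b2b-balaban-gan24-formalise-leaf-04`, gen 38).  NEVER «G-an2-4 closed»; NOT D1, NOT BetaPertH, NOT continuum, NOT Clay.

THE OBSERVATION (located).  In `StripLegReadout.kFibW_inl_eq` the column's fibre function at the reading representative `zx ∈ (ℤ∕L)⁴` is
`Σ_m sf·readW N M p m κ (repZ zx)·a_m` with the arrow amplitude `a_m` INDEPENDENT of `zx`, and `readW … (repZ zx) = Φ_L(p,zx)·boxChar (cls L m) zx·(S_M s_{M,κ}∕M⁵)(m)`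
(§1; `M∕N = 1∕L`; `|Φ_L| ≤ e^{4η}`).  So `AliasClassSum.sum_norm_sq_boxChar_cls_le` (Parseval over the box, Cauchy–Schwarz INSIDE each class, class weight `≤ 5⁴`) and road P1's
a-priori step over all aliases (`exists_arrow_eq`, `sum_aSlot_le`, `sum_packSrc_inr_le`) give `Σ_{zx}‖kFibW…‖² ≤ e^{2ηD}·L^D·sf²·6^{D+1}·5^D·A²·(RQ·sm·‖cphase‖)²` — `L^D` where
the termwise route pays `L^{2D}`; in the adopted units (`sf = M`, `sm = M⁴`, `RQ = N⁻⁵`, `N = L·M`; `StripLegUnitsJM.unit_fm_m`) that is `A²e^{8η}6⁵5⁴·(L⁶)⁻¹`, and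
`Σ_{zx}‖·‖ ≤ L²·√(…) ≤ A·e^{4η}·5400·L⁻¹`.  TRUTH CHECK: natural-units column `O(1)` on `|x| ≲ L` × adopted-unit factor `L⁻⁵`: box-sum of the fibre sup `≍ L⁴·L⁻⁵`.

CONTENT (`D = d+1`; §1–§2 generic `d`, §3–§4 at `d = 3`; [our object] ∕ [folklore]; 0 cited fact, 0 sorry; two displayed data defs `rdPhase`, `rdAmp`):
§1 `readW_repZ_eq` (`N = L·M`), `norm_rdPhase_le` (`≤ e^{ηD}`), `norm_rdAmp_sq_le`; §2 `kFibW_inl_repZ_eq`, **`sum_norm_kFibW_inl_sq_le`** ∕ **`sum_norm_kFibW_fm_sq_le`** (the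
box-summed (U2) as a function of the a-priori constant `A`, hypothesis `hAP` verbatim as in `StripLegReadout.norm_kFibW_inl_sq_le`; NO `|Re p_i| ≤ π` needed); §3 (`d = 3`)
`sum_norm_kFibW_jm_fm_sq_le`, **`sum_norm_kFibW_jm_fm_le_of_inv_bound`** (`Σ_{zx} ‖kFibW …‖ ≤ A·e^{4η}·5400·((Lc:ℝ)^m)⁻¹`); §4 **`stripRegular_fm_uniform_box`** (every `Lc ≥ 1`):
ONE `κ ∈ (0, 1∕4]` such that for ALL `m j zy κ′ l` every representative's re-based fibre function is `StripRegular … κ C_m` AND `∀ p ∈ Strip 4 κ, Σ_{zx} ‖kFibΔM …‖ ≤ C_m`,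
`C_m = (5 + 2·aR 4)·e^{4κ}·5400·((Lc:ℝ)^m)⁻¹` (p229339 §2's route, rows F3–F6 and (U1) BY NAME, `∀ m` inside `exists_radii`).  Consumer: `FP/PerfectColumnMass`.

ABSOLUTE RULE (cell, verbatim): «No internally-minted statement may enter as a cited fact. Every hypothesis is either kernel-proved in this package or a
verbatim quotation of a PUBLISHED theorem with page reference.»  Nothing is cited; no `def … : Prop`; no wall binder instantiated at a value.
-/

noncomputable section

open Matrix Complex Finset Filter Topology
open scoped Matrix.Norms.L2Operator Real BigOperators ComplexConjugate
open Literature.MathematicalPhysics.QuantumFieldTheory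
open Literature.MathematicalPhysics.QuantumFieldTheory.Balaban1983to89
open Literature.MathematicalPhysics.QuantumFieldTheory.Balaban1983to89.Beta
open Literature.MathematicalPhysics.QuantumFieldTheory.LatticeForm (quo repZ proj_repZ)
open Literature.Probability.LatticeModels (TorusSite Torus.proj Torus.proj_apply)
open B4Strip (Strip reVec ofRealVec)
open B4ContourShift (BZ StripRegular)
open BlochFibreMatrix (stencil pieceMatrix repZ_nonneg repZ_lt)
open FibreInverseDecay (trigPolySymbol reVec_mem_BZ cphase)
open OneStepResolventKernel (Fib)
open AffineAveraging (Site)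
open Summit.QuantumFields.BalabanUV.Beta.GAN24
open CombesThomas (sfStep smStep)
open CombesThomasFibreStep (kFibW cphase_zero_left)
open ArrowOperator ArrowScaling
open ArrowAnchorZero (isUnit_innerArrow_zero)
open ArrowAnchorReal (aR aR_pos arrowAnchorReal)
open FibreDetStripOfAnchors (exists_radii)
open FibreDetStrip (apriori_of_rows det_ne_zero_of_rows abs_le_pi_of_mem_BZ)
open StripLegUnits (lc_pos pow_pos')
open StripLegUnitsJM (pow_le_pow_add quo_pow_add_smul_repZ unit_fm_m)
open FibreStripOfRows (sigR rhoR sigR_pos sigR_A rhoR_Q apriori_sq_of_inv_bound radI_hyps radO_hyps)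
open FibreStrip (omegaOut OmegaOut omegaOut_le OmegaOut_nonneg cOut4 cOut4_nonneg)
open FibreStripJM (kFibΔM kFibΔM_repZ_eq_kFibW kFibΔM_eq_repZ stripRegular_kFibΔM)
open FibreStripJMHolds (one_le_pow_add)
open AliasWeights (sinWt sinWt_pos sinWt_le_one kfine)
open AliasObjects (kAl kAl_apply readW sMAl SMAl)
open StripAliasWeights (norm_sMAl_sq_le_strip norm_SMAl_sq_le_strip)
open StripLegVectors (core_sq_le)
open FibreDFT (boxChar boxChar_comm boxChar_proj)
open FibreDFTDictionary (ampA ampμ)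
open KFibClosedForm (legCoef)
open KFibLegSource (legSrcVec)
open StripLegReadout (solVec kFibW_inl_eq exists_arrow_eq arrow_injective_of_apriori sum_aSlot_le sum_packSrc_inr_le)
open AliasClassSum (cls cls_val sum_cls_prod_sinWt_le sum_norm_sq_boxChar_cls_le)
open Summit.QuantumFields.BalabanUV.Beta.FP.PerfectColumnUniform (legBound_jm_fm_of_inv_bound sqrt_fm_const_le)

namespace Summit.QuantumFields.BalabanUV.Beta.FP.PerfectColumnMassFibre

/-! ## §1 The reading weight at a box representative: phase × class character × phase-free amplitude -/

section Reading

variable {d : ℕ} {L M N : ℕ} [NeZero L] [NeZero N]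

/-- [our object] THE READING PHASE AT THE RATIO `M∕N = 1∕L`: `Φ_L(p, zx) = exp(i·Σ_i p_i·(repZ zx)_i ∕ L)`. -/
def rdPhase (L : ℕ) (p : Fin (d + 1) → ℂ) (zx : TorusSite (d + 1) L) : ℂ :=
  cexp (I * ∑ i, p i * (repZ zx i : ℂ) / (L : ℂ))

/-- [our object] THE PHASE-FREE READING AMPLITUDE `S_M(m)·s_{M,κ}(m) ∕ M^{D+1}` (`AliasObjects.readW` without its offset phase). -/
def rdAmp (N M : ℕ) [NeZero N] (p : Fin (d + 1) → ℂ) (m : TorusSite (d + 1) N) (κ : Fin (d + 1)) : ℂ :=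
  SMAl N M p m * sMAl N M p m κ / (M : ℂ) ^ (d + 1 + 1)

omit [NeZero L] in
/-- [folklore] The class mod `L` of an alias is the torus projection of its representative: `cls L m = proj L (repZ m)`. -/
theorem cls_eq_proj (m : TorusSite (d + 1) N) : cls L m = Torus.proj L (repZ m) := by
  funext i; simp [cls, Torus.proj_apply, repZ]

/-- [folklore] THE CLASS CHARACTER AS A PLANE WAVE IN THE FULL REPRESENTATIVE: `boxChar (cls L m) zx = exp(i·Σ_i (2π (repZ zx)_i ∕ L)·(repZ m)_i)`. -/
theorem boxChar_cls_eq (m : TorusSite (d + 1) N) (zx : TorusSite (d + 1) L) :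
    boxChar (cls L m) zx = cexp (I * ∑ i, (2 * π * (repZ zx i : ℂ) / (L : ℂ)) * (repZ m i : ℂ)) := by
  rw [boxChar_comm, cls_eq_proj, boxChar_proj]; rfl

/-- [folklore] **THE READING WEIGHT AT A BOX REPRESENTATIVE FACTORS THROUGH THE CLASS** (`N = L·M`): `readW N M p m κ (repZ zx) = Φ · boxChar (cls L m) zx · rdAmp`. -/
theorem readW_repZ_eq (hN : N = L * M) (p : Fin (d + 1) → ℂ) (m : TorusSite (d + 1) N) (κ : Fin (d + 1)) (zx : TorusSite (d + 1) L) :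
    readW N M p m κ (repZ zx) = rdPhase L p zx * boxChar (cls L m) zx * rdAmp N M p m κ := by
  have hL : (L : ℂ) ≠ 0 := Nat.cast_ne_zero.2 (NeZero.ne L)
  have hM : (M : ℂ) ≠ 0 := fun h =>
    Nat.cast_ne_zero.2 (NeZero.ne N) (by rw [hN, Nat.cast_mul, h, mul_zero] : (N : ℂ) = 0)
  have hNc : (N : ℂ) = (L : ℂ) * M := by rw [hN, Nat.cast_mul]
  unfold readW rdPhase rdAmp
  rw [boxChar_cls_eq]
  have hexp : I * ∑ i, kAl N p m i * ((M : ℂ) * (repZ zx i : ℂ))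
      = I * ∑ i, p i * (repZ zx i : ℂ) / (L : ℂ) + I * ∑ i, (2 * π * (repZ zx i : ℂ) / (L : ℂ)) * (repZ m i : ℂ) := by
    rw [← mul_add, ← Finset.sum_add_distrib]
    exact congrArg _ (Finset.sum_congr rfl fun i _ => by rw [kAl_apply, hNc]; field_simp)
  rw [hexp, Complex.exp_add]; ring

omit [NeZero N] in
/-- [folklore] **THE READING PHASE IS `≤ e^{ηD}` IN MODULUS** on `|Im p_i| ≤ η` (`0 ≤ (repZ zx)_i < L`). -/
theorem norm_rdPhase_le {p : Fin (d + 1) → ℂ} {η : ℝ} (him : ∀ i, |(p i).im| ≤ η) (zx : TorusSite (d + 1) L) :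
    ‖rdPhase L p zx‖ ≤ Real.exp (η * (d + 1)) := by
  have hL : (0 : ℝ) < L := Nat.cast_pos.2 (Nat.pos_of_ne_zero (NeZero.ne L))
  unfold rdPhase; rw [Complex.norm_exp]; refine Real.exp_le_exp.2 ?_
  have hre : (I * ∑ i, p i * (repZ zx i : ℂ) / (L : ℂ)).re = -∑ i, (p i).im * (repZ zx i : ℝ) / L := by
    rw [Complex.mul_re, Complex.I_re, Complex.I_im, zero_mul, one_mul, zero_sub, Complex.im_sum]
    exact congrArg _ (Finset.sum_congr rfl fun i _ => by
      rw [Complex.div_natCast_im, Complex.mul_im, Complex.intCast_re, Complex.intCast_im, mul_zero, zero_add])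
  rw [hre, ← Finset.sum_neg_distrib]
  have hterm : ∀ i, -((p i).im * (repZ zx i : ℝ) / L) ≤ η := by
    intro i
    have h0 : (0 : ℝ) ≤ (repZ zx i : ℝ) := by exact_mod_cast repZ_nonneg zx i
    have hq : (repZ zx i : ℝ) / L ≤ 1 := by rw [div_le_one hL]; exact_mod_cast (repZ_lt zx i).le
    have hq0 : 0 ≤ (repZ zx i : ℝ) / L := div_nonneg h0 hL.le
    have hη0 : 0 ≤ η := (abs_nonneg _).trans (him i)
    calc -((p i).im * (repZ zx i : ℝ) / L) = (-(p i).im) * ((repZ zx i : ℝ) / L) := by ring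
      _ ≤ |(p i).im| * ((repZ zx i : ℝ) / L) := mul_le_mul_of_nonneg_right (neg_le_abs _) hq0
      _ ≤ η * 1 := mul_le_mul (him i) hq hq0 hη0
      _ = η := mul_one η
  calc ∑ i, -((p i).im * (repZ zx i : ℝ) / L) ≤ ∑ _i : Fin (d + 1), η := Finset.sum_le_sum fun i _ => hterm i
    _ = η * (d + 1) := by rw [Finset.sum_const, Finset.card_univ, Fintype.card_fin, nsmul_eq_mul]; push_cast; ring

/-- [folklore] **THE PHASE-FREE READING AMPLITUDE ON THE STRIP**: `‖rdAmp N M p m κ‖² ≤ 6^{D+1}·Π_i sinWt M (kfine N (Re p) m i)` (`|Im p_i| ≤ η ≤ 1∕4`, `0 < M ≤ N`). -/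
theorem norm_rdAmp_sq_le {p : Fin (d + 1) → ℂ} {η : ℝ} (him : ∀ i, |(p i).im| ≤ η) (hη : 0 ≤ η) (hη4 : η ≤ 1 / 4) (hM : 0 < M) (hMN : M ≤ N)
    (m : TorusSite (d + 1) N) (κ : Fin (d + 1)) :
    ‖rdAmp N M p m κ‖ ^ 2 ≤ (6 : ℝ) ^ (d + 1 + 1) * ∏ i, sinWt M (kfine N (reVec p) m i) := by
  have hP : 0 ≤ ∏ i, sinWt M (kfine N (reVec p) m i) := Finset.prod_nonneg fun i _ => (sinWt_pos _ _).le
  have hs : ‖sMAl N M p m κ‖ ^ 2 ≤ 6 * (M : ℝ) ^ 2 :=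
    (norm_sMAl_sq_le_strip him hη hη4 hMN m κ).trans (mul_le_of_le_one_right (by positivity) (sinWt_le_one _ _))
  have h := core_sq_le (E := (1 : ℂ)) (e := 1) hM (by rw [norm_one]) (norm_SMAl_sq_le_strip him hη hη4 hMN m) hs hP
  have hnorm : ‖rdAmp N M p m κ‖ = ‖(1 : ℂ)‖ * ‖SMAl N M p m‖ * ‖sMAl N M p m κ‖ / (M : ℝ) ^ (d + 1 + 1) := by
    unfold rdAmp; rw [norm_div, norm_mul, norm_pow, Complex.norm_natCast, norm_one, one_mul]
  rw [hnorm]; simpa only [one_pow, one_mul] using h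

end Reading

/-! ## §2 The box-summed readout bound as a function of the a-priori constant -/

section Box

variable {d : ℕ} {L M N : ℕ} [NeZero L] [NeZero M] [NeZero N]
variable {p : Fin (d + 1) → ℂ} {η : ℝ} {sf sm : ℝ} {σ ρ : AIdx (d + 1) (TorusSite (d + 1) N) → ℝ} {A RQ : ℝ}

omit [NeZero M] in
/-- [folklore] **THE COLUMN'S FIBRE FUNCTION AT A BOX REPRESENTATIVE, CLASS FORM** (`N = L·M`): `kFibW … (inl κ) (repZ zx) b y′ p = Φ_L(p,zx)·Σ_m (sf·rdAmp)(m)·a_m·boxChar (cls L m) zx`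
with the arrow amplitude `a_m = ampA p (solVec …) m κ` independent of `zx`. -/
theorem kFibW_inl_repZ_eq (hN : N = L * M) (κ : Fin (d + 1)) (zx : TorusSite (d + 1) L) (b : Fib d) (y' : Site (d + 1)) :
    kFibW N M sf sm (Sum.inl κ) (repZ zx) b y' p =
      rdPhase L p zx * ∑ m : TorusSite (d + 1) N, ((sf : ℂ) * rdAmp N M p m κ) *
        ampA p (solVec N M p (legCoef M sf sm b) b y') m κ * boxChar (cls L m) zx := by
  rw [kFibW_inl_eq, Finset.mul_sum]
  exact Finset.sum_congr rfl fun m _ => by rw [readW_repZ_eq hN]; ring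

/-- [folklore] **THE BOX-SUMMED (U2), GENERIC FORM**: under the scaled a-priori bound `hAP` with A-slot weights `σ ≤ 1`, on `|Im p_i| ≤ η ≤ 1∕4` (`0 < M ≤ N`, `N = L·M`),
`Σ_{zx ∈ (ℤ∕L)^D} ‖kFibW … (inl κ) (repZ zx) b y′ p‖² ≤ e^{2ηD}·(L^D·sf²·6^{D+1}·5^D)·A²·Σ_i (ρ_i‖(packSrc p legSrcVec)_i‖)²` (Parseval over the box, Cauchy–Schwarz INSIDE
each class — `AliasClassSum.sum_norm_sq_boxChar_cls_le`, class weight `sum_cls_prod_sinWt_le` — and road P1's a-priori step over ALL aliases). -/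
theorem sum_norm_kFibW_inl_sq_le (hN : N = L * M) (him : ∀ i, |(p i).im| ≤ η) (hη : 0 ≤ η) (hη4 : η ≤ 1 / 4) (hM : 0 < M) (hMN : M ≤ N)
    (hσ : ∀ i, 0 < σ i) (hσA : ∀ m κ, σ (Sum.inl (Sum.inl κ, m)) ≤ 1)
    (hAP : ∀ x, ∑ i, (‖x i‖ / σ i) ^ 2 ≤ A ^ 2 * ∑ i, (ρ i * ‖(arrowMat (aliasArrow N p) *ᵥ x) i‖) ^ 2)
    (κ : Fin (d + 1)) (b : Fib d) (y' : Site (d + 1)) :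
    ∑ zx : TorusSite (d + 1) L, ‖kFibW N M sf sm (Sum.inl κ) (repZ zx) b y' p‖ ^ 2 ≤
      Real.exp (η * (d + 1)) ^ 2 * (((L : ℝ) ^ (d + 1) * (sf ^ 2 * ((6 : ℝ) ^ (d + 1 + 1) * (5 : ℝ) ^ (d + 1)))) *
        (A ^ 2 * ∑ i, (ρ i * ‖packSrc p (legSrcVec N M p (legCoef M sf sm b) b y') i‖) ^ 2)) := by
  obtain ⟨c, hc⟩ := exists_arrow_eq p (arrow_injective_of_apriori p σ ρ hσ hAP) M (legCoef M sf sm b) b y'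
  set v := solVec N M p (legCoef M sf sm b) b y' with hv
  set xx := pack (ampA p v) (ampμ p v) (fun κ => v (Sum.inr (Sum.inr κ))) c with hxx
  set a : TorusSite (d + 1) N → ℂ := fun m => ampA p v m κ with ha
  -- termwise: strip the reading phase
  have hterm : ∀ zx : TorusSite (d + 1) L, ‖kFibW N M sf sm (Sum.inl κ) (repZ zx) b y' p‖ ^ 2 ≤
      Real.exp (η * (d + 1)) ^ 2 * ‖∑ m : TorusSite (d + 1) N, ((sf : ℂ) * rdAmp N M p m κ) * a m * boxChar (cls L m) zx‖ ^ 2 := by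
    intro zx
    rw [kFibW_inl_repZ_eq hN, norm_mul, mul_pow]
    exact mul_le_mul_of_nonneg_right (pow_le_pow_left₀ (norm_nonneg _) (norm_rdPhase_le him zx) 2) (sq_nonneg _)
  -- the class-Parseval bound
  have hw : ∀ m : TorusSite (d + 1) N, (σ (Sum.inl (Sum.inl κ, m)) * ‖(sf : ℂ) * rdAmp N M p m κ‖) ^ 2 ≤
      sf ^ 2 * ((6 : ℝ) ^ (d + 1 + 1) * ∏ i, sinWt M (kfine N (reVec p) m i)) := by
    intro m
    have h1 : (σ (Sum.inl (Sum.inl κ, m)) * ‖(sf : ℂ) * rdAmp N M p m κ‖) ^ 2 ≤ ‖(sf : ℂ) * rdAmp N M p m κ‖ ^ 2 := by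
      have hs0 := (hσ (Sum.inl (Sum.inl κ, m))).le
      refine pow_le_pow_left₀ (by positivity) ?_ 2
      nlinarith [hσA m κ, norm_nonneg ((sf : ℂ) * rdAmp N M p m κ)]
    refine h1.trans ?_
    rw [norm_mul, Complex.norm_real, Real.norm_eq_abs, mul_pow, sq_abs]
    exact mul_le_mul_of_nonneg_left (norm_rdAmp_sq_le him hη hη4 hM hMN m κ) (sq_nonneg _)
  have hW : ∀ m' : TorusSite (d + 1) L, ∑ m ∈ Finset.univ.filter (fun m : TorusSite (d + 1) N => cls L m = m'),
      sf ^ 2 * ((6 : ℝ) ^ (d + 1 + 1) * ∏ i, sinWt M (kfine N (reVec p) m i)) ≤ sf ^ 2 * ((6 : ℝ) ^ (d + 1 + 1) * (5 : ℝ) ^ (d + 1)) := by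
    intro m'
    rw [← Finset.mul_sum, ← Finset.mul_sum]
    exact mul_le_mul_of_nonneg_left (mul_le_mul_of_nonneg_left (sum_cls_prod_sinWt_le hN (reVec p) m') (by positivity)) (sq_nonneg _)
  have hcls := sum_norm_sq_boxChar_cls_le (L := L) (fun m => (sf : ℂ) * rdAmp N M p m κ) a (fun m => σ (Sum.inl (Sum.inl κ, m)))
    (fun m => sf ^ 2 * ((6 : ℝ) ^ (d + 1 + 1) * ∏ i, sinWt M (kfine N (reVec p) m i))) (fun m => hσ _) hw hW
  -- the a-priori step over all aliases
  have hx : ∑ m : TorusSite (d + 1) N, (‖a m‖ / σ (Sum.inl (Sum.inl κ, m))) ^ 2 ≤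
      A ^ 2 * ∑ i, (ρ i * ‖packSrc p (legSrcVec N M p (legCoef M sf sm b) b y') i‖) ^ 2 := by
    have hsub := sum_aSlot_le (N := N) (fun i => (‖xx i‖ / σ i) ^ 2) (fun i => sq_nonneg _) κ
    have hxxA : ∀ m, xx (Sum.inl (Sum.inl κ, m)) = a m := fun m => rfl
    simp only [hxxA] at hsub
    refine hsub.trans ?_
    rw [← hc]
    exact hAP xx
  refine (Finset.sum_le_sum fun zx _ => hterm zx).trans ?_
  rw [← Finset.mul_sum]
  exact mul_le_mul_of_nonneg_left (hcls.trans (mul_le_mul_of_nonneg_left hx (by positivity))) (sq_nonneg _)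

/-- [folklore] **THE BOX-SUMMED (U2) OF THE FIELD–MULTIPLIER QUARTER**: with the Q-row weight `|ρ(Q_l)| ≤ RQ` and `sm ≥ 0`,
`Σ_{zx} ‖kFibW … (inl κ) (repZ zx) (inr l) y′ p‖² ≤ e^{2ηD}·(L^D·sf²·6^{D+1}·5^D)·A²·(RQ·sm·‖cphase(−quo N (M•y′)) p‖)²`. -/
theorem sum_norm_kFibW_fm_sq_le (hN : N = L * M) (him : ∀ i, |(p i).im| ≤ η) (hη : 0 ≤ η) (hη4 : η ≤ 1 / 4) (hM : 0 < M) (hMN : M ≤ N)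
    (hσ : ∀ i, 0 < σ i) (hσA : ∀ m κ, σ (Sum.inl (Sum.inl κ, m)) ≤ 1) (hRQ : 0 ≤ RQ) (hsm : 0 ≤ sm)
    (hAP : ∀ x, ∑ i, (‖x i‖ / σ i) ^ 2 ≤ A ^ 2 * ∑ i, (ρ i * ‖(arrowMat (aliasArrow N p) *ᵥ x) i‖) ^ 2)
    (κ : Fin (d + 1)) (l : Fin (d + 1)) (y' : Site (d + 1)) (hρQ : |ρ (Sum.inr (Sum.inl l))| ≤ RQ) :
    ∑ zx : TorusSite (d + 1) L, ‖kFibW N M sf sm (Sum.inl κ) (repZ zx) (Sum.inr l) y' p‖ ^ 2 ≤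
      Real.exp (η * (d + 1)) ^ 2 * (((L : ℝ) ^ (d + 1) * (sf ^ 2 * ((6 : ℝ) ^ (d + 1 + 1) * (5 : ℝ) ^ (d + 1)))) *
        (A ^ 2 * (RQ * sm * ‖cphase (-quo N ((M : ℤ) • y')) p‖) ^ 2)) := by
  refine (sum_norm_kFibW_inl_sq_le hN him hη hη4 hM hMN hσ hσA hAP κ (Sum.inr l) y').trans ?_
  have hK : 0 ≤ (L : ℝ) ^ (d + 1) * (sf ^ 2 * ((6 : ℝ) ^ (d + 1 + 1) * (5 : ℝ) ^ (d + 1))) := by positivity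
  exact mul_le_mul_of_nonneg_left (mul_le_mul_of_nonneg_left (mul_le_mul_of_nonneg_left (sum_packSrc_inr_le hRQ hsm l y' hρQ) (sq_nonneg _)) hK)
    (sq_nonneg _)

end Box

/-! ## §3 The adopted units (`d = 3`): `Σ_{zx} ‖·‖² ≤ A²e^{8η}6⁵5⁴·((Lc^m)⁶)⁻¹` and `Σ_{zx} ‖·‖ ≤ A·e^{4η}·5400·(Lc^m)⁻¹` -/

section Units

variable {Lc : ℕ} [NeZero Lc]

/-- [folklore] **THE BOX-SUMMED (U2) IN THE ADOPTED UNITS** (`d = 3`, blocking `N = Lc^(j+m)`, decimation `M = Lc^j`, `L = Lc^m`; only the A-slot bound `σ ≤ 1` and the Q-row bound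
`|ρ| ≤ N⁻⁵` are used): `Σ_{zx ∈ (ℤ∕Lc^m)⁴} ‖kFibW (Lc^(j+m)) (Lc^j) (sfStep Lc j) (smStep 3 Lc j) (inl κ) (repZ zx) (inr l) (repZ zy) p‖² ≤ A²·(e^{4η})²·6⁵·5⁴·(((Lc:ℝ)^m)⁶)⁻¹`
(`StripLegUnitsJM.unit_fm_m`'s `sf²·(N⁻⁵sm)² = (L^{10})⁻¹` times the box factor `L⁴`). -/
theorem sum_norm_kFibW_jm_fm_sq_le {η A : ℝ} (hη : 0 ≤ η) (hη4 : η ≤ 1 / 4) (m j : ℕ) {p : Fin 4 → ℂ} (him : ∀ i, |(p i).im| ≤ η)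
    (σ ρ : AIdx 4 (TorusSite 4 (Lc ^ (j + m))) → ℝ) (hσ : ∀ i, 0 < σ i) (hσA : ∀ n κ, σ (Sum.inl (Sum.inl κ, n)) ≤ 1)
    (hρQ : ∀ κ, |ρ (Sum.inr (Sum.inl κ))| ≤ (((Lc : ℝ) ^ (j + m)) ^ 5)⁻¹)
    (hAP : ∀ x, ∑ i, (‖x i‖ / σ i) ^ 2 ≤ A ^ 2 * ∑ i, (ρ i * ‖(arrowMat (aliasArrow (Lc ^ (j + m)) p) *ᵥ x) i‖) ^ 2)
    (κ l : Fin (3 + 1)) (zy : TorusSite 4 (Lc ^ m)) :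
    ∑ zx : TorusSite 4 (Lc ^ m), ‖kFibW (Lc ^ (j + m)) (Lc ^ j) (sfStep Lc j) (smStep 3 Lc j) (Sum.inl κ) (repZ zx) (Sum.inr l) (repZ zy) p‖ ^ 2 ≤
      A ^ 2 * (Real.exp (η * 4) ^ 2 * ((6 : ℝ) ^ 5 * (5 : ℝ) ^ 4) * (((Lc : ℝ) ^ m) ^ 6)⁻¹) := by
  have hl0 : (Lc : ℝ) ≠ 0 := (lc_pos (Lc := Lc)).ne'
  have hM : 0 < Lc ^ j := pow_pos' j
  have hMN : Lc ^ j ≤ Lc ^ (j + m) := pow_le_pow_add j m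
  have hN : Lc ^ (j + m) = Lc ^ m * Lc ^ j := by rw [pow_add, mul_comm]
  have hsf : sfStep Lc j = (Lc : ℝ) ^ j := rfl
  have hsm : smStep 3 Lc j = (Lc : ℝ) ^ (j * 4) := rfl
  have hsm0 : 0 ≤ smStep 3 Lc j := hsm ▸ by positivity
  have hφy : cphase (-quo (Lc ^ (j + m)) (((Lc ^ j : ℕ) : ℤ) • repZ zy)) p = 1 := by
    rw [quo_pow_add_smul_repZ, neg_zero, cphase_zero_left]
  have h := sum_norm_kFibW_fm_sq_le (L := Lc ^ m) (N := Lc ^ (j + m)) (M := Lc ^ j) (sf := sfStep Lc j) (sm := smStep 3 Lc j) hN him hη hη4 hM hMN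
    hσ hσA (by positivity) hsm0 hAP κ l (repZ zy) (hρQ l)
  rw [hsf, hsm, hφy, norm_one, mul_one, Nat.cast_pow] at h
  have hE4 : Real.exp (η * ((3 : ℕ) + 1 : ℝ)) = Real.exp (η * 4) := by norm_num
  rw [hE4] at h
  set E : ℝ := Real.exp (η * 4) with hE
  set l' : ℝ := (Lc : ℝ) with hldef
  have hL : l' ^ m ≠ 0 := pow_ne_zero _ hl0
  have hunit : (l' ^ m) ^ (3 + 1) * ((l' ^ j) ^ 2 * ((((l' ^ (j + m)) ^ 5)⁻¹ * l' ^ (j * 4)) ^ 2)) = ((l' ^ m) ^ 6)⁻¹ := by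
    rw [unit_fm_m hl0 j m]; field_simp
  calc _ ≤ _ := h
    _ = A ^ 2 * (E ^ 2 * ((6 : ℝ) ^ (3 + 1 + 1) * (5 : ℝ) ^ (3 + 1)) *
          ((l' ^ m) ^ (3 + 1) * ((l' ^ j) ^ 2 * ((((l' ^ (j + m)) ^ 5)⁻¹ * l' ^ (j * 4)) ^ 2)))) := by ring
    _ = A ^ 2 * (E ^ 2 * ((6 : ℝ) ^ 5 * (5 : ℝ) ^ 4) * ((l' ^ m) ^ 6)⁻¹) := by rw [hunit]

/-- [folklore] The box `(ℤ∕Lc^m)⁴` has `((Lc:ℝ)^m)⁴` points. -/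
theorem card_torusSite_four (m : ℕ) : (Fintype.card (TorusSite 4 (Lc ^ m)) : ℝ) = ((Lc : ℝ) ^ m) ^ 4 := by
  rw [Fintype.card_pi, Finset.prod_const, ZMod.card, Finset.card_univ, Fintype.card_fin]; push_cast; ring

/-- [folklore] `ℓ¹ ≤ √card · ℓ²` on a finite index set: `Σ_i f i ≤ √(card · Σ_i (f i)²)` for `f ≥ 0`. -/
theorem sum_le_sqrt_card_mul_sum_sq {ι : Type*} [Fintype ι] (f : ι → ℝ) :
    ∑ i, f i ≤ Real.sqrt (Fintype.card ι * ∑ i, f i ^ 2) := by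
  refine Real.le_sqrt_of_sq_le ?_
  have h := Finset.sum_mul_sq_le_sq_mul_sq Finset.univ (fun _ : ι => (1 : ℝ)) f
  simp only [one_mul, one_pow, Finset.sum_const, Finset.card_univ, nsmul_eq_mul, mul_one] at h
  exact h

/-- [folklore] **THE BOX-SUMMED (U2) AT ONE STRIP POINT, RELATIVE BLOCKING `Lc^m`**: on `|Im p_i| ≤ η ≤ 1∕4`, an inverse bound `A ≥ 0` of the scaled arrow matrix at `N = Lc^(j+m)`
with radii `r` (`r_n > 0`, `r₀ > 0`) gives `Σ_{zx ∈ (ℤ∕Lc^m)⁴} ‖kFibW (Lc^(j+m)) (Lc^j) (sfStep Lc j) (smStep 3 Lc j) (inl κ) (repZ zx) (inr l) (repZ zy) p‖ ≤ A·exp(η·4)·5400·((Lc:ℝ)^m)⁻¹`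
— the box analogue of p229339's `legBound_jm_fm_of_inv_bound`, with the SAME constant for the SUM over the `(Lc^m)⁴` representatives (`√(L⁴·(L⁶)⁻¹) = L⁻¹`). -/
theorem sum_norm_kFibW_jm_fm_le_of_inv_bound {η A r0 : ℝ} (hη : 0 ≤ η) (hη4 : η ≤ 1 / 4) (hA0 : 0 ≤ A) (m j : ℕ) {p : Fin 4 → ℂ}
    (him : ∀ i, |(p i).im| ≤ η) (r : TorusSite 4 (Lc ^ (j + m)) → ℝ) (hr : ∀ n, 0 < r n) (hr0 : 0 < r0)
    (hU : IsUnit (arrowMat (scaledArrow (Lc ^ (j + m)) r r0 p))) (hA : ‖(arrowMat (scaledArrow (Lc ^ (j + m)) r r0 p))⁻¹‖ ≤ A)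
    (κ l : Fin (3 + 1)) (zy : TorusSite 4 (Lc ^ m)) :
    ∑ zx : TorusSite 4 (Lc ^ m), ‖kFibW (Lc ^ (j + m)) (Lc ^ j) (sfStep Lc j) (smStep 3 Lc j) (Sum.inl κ) (repZ zx) (Sum.inr l) (repZ zy) p‖ ≤
      A * Real.exp (η * 4) * 5400 * ((Lc : ℝ) ^ m)⁻¹ := by
  have hLm : (0 : ℝ) < (Lc : ℝ) ^ m := pow_pos lc_pos m
  have hsq := sum_norm_kFibW_jm_fm_sq_le hη hη4 m j him (sigR (Lc ^ (j + m)) r r0) (rhoR (Lc ^ (j + m)) r r0) (sigR_pos hr hr0)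
    (fun n κ => by rw [sigR_A]) (fun κ => by rw [rhoR_Q, Nat.cast_pow, abs_of_nonneg (by positivity)]) (apriori_sq_of_inv_bound hr hr0 p hU hA) κ l zy
  set f : TorusSite 4 (Lc ^ m) → ℝ := fun zx =>
    ‖kFibW (Lc ^ (j + m)) (Lc ^ j) (sfStep Lc j) (smStep 3 Lc j) (Sum.inl κ) (repZ zx) (Sum.inr l) (repZ zy) p‖ with hf
  have h1 := sum_le_sqrt_card_mul_sum_sq f
  rw [card_torusSite_four] at h1
  refine h1.trans ?_
  have h2 : ((Lc : ℝ) ^ m) ^ 4 * ∑ zx, f zx ^ 2 ≤ A ^ 2 * (Real.exp (η * 4) ^ 2 * ((6 : ℝ) ^ 5 * (5 : ℝ) ^ 4) * (((Lc : ℝ) ^ m) ^ 2)⁻¹) := by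
    calc ((Lc : ℝ) ^ m) ^ 4 * ∑ zx, f zx ^ 2 ≤ ((Lc : ℝ) ^ m) ^ 4 * (A ^ 2 * (Real.exp (η * 4) ^ 2 * ((6 : ℝ) ^ 5 * (5 : ℝ) ^ 4) * (((Lc : ℝ) ^ m) ^ 6)⁻¹)) :=
          mul_le_mul_of_nonneg_left hsq (by positivity)
      _ = A ^ 2 * (Real.exp (η * 4) ^ 2 * ((6 : ℝ) ^ 5 * (5 : ℝ) ^ 4) * (((Lc : ℝ) ^ m) ^ 2)⁻¹) := by
          have hL : (Lc : ℝ) ^ m ≠ 0 := hLm.ne'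
          field_simp
  exact (Real.sqrt_le_sqrt h2).trans (sqrt_fm_const_le hA0 (Real.exp_pos _).le hLm)

end Units

/-! ## §4 ONE strip half-width for the column quarter, with the box-summed bound, at every relative blocking -/

section OneStrip

variable {Lc : ℕ} [NeZero Lc]

/-- **ONE STRIP FOR THE COLUMN QUARTER AT ALL RELATIVE BLOCKINGS, TERMWISE AND BOX-SUMMED** [our object] (`d = 3`, every `Lc ≥ 1`): there is `κ ∈ (0, 1∕4]` such that for EVERY `m`,
`j`, source representative `zy` and components `κ′ l`, with `C_m := (5 + 2·aR 4)·exp(κ·4)·5400·((Lc:ℝ)^m)⁻¹`: (i) every reading representative's re-based (j, m)-fibre function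
`kFibΔM Lc (sfStep Lc) (smStep 3 Lc) m j (inl κ′) (repZ zx) (inr l) (repZ zy)` is `StripRegular … κ C_m` (p229339 §2, re-derived under the same radii), and (ii) **the SUM over the
`(Lc^m)⁴` reading representatives obeys the same bound**: `∀ p ∈ Strip 4 κ, Σ_{zx} ‖kFibΔM … (repZ zx) … p‖ ≤ C_m`.  Route of `FibreStripJMHolds.stripRegularKM_of_rows` with `∀ m`
INSIDE `exists_radii` (rows F3 `isUnit_innerArrow_zero`, F4 `ArrowInnerShift.exists_cIn 3`, F5 `arrowAnchorReal`, F6 `ArrowOuterShift.outerLipschitz`; (U1) `det_ne_zero_of_rows` ∕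
`apriori_of_rows` at `N := Lc^(j+m)`), the two (U2)'s being p229339's `legBound_jm_fm_of_inv_bound` and §3's `sum_norm_kFibW_jm_fm_le_of_inv_bound`. -/
theorem stripRegular_fm_uniform_box : ∃ κ : ℝ, 0 < κ ∧ κ ≤ 1 / 4 ∧
    ∀ (m j : ℕ) (zy : TorusSite (3 + 1) (Lc ^ m)) (κ' l : Fin (3 + 1)),
      (∀ zx : TorusSite (3 + 1) (Lc ^ m),
        StripRegular (kFibΔM Lc (sfStep Lc) (smStep 3 Lc) m j (Sum.inl κ') (repZ zx) (Sum.inr l) (repZ zy)) κ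
          ((5 + 2 * aR 4) * Real.exp (κ * 4) * 5400 * ((Lc : ℝ) ^ m)⁻¹)) ∧
      ∀ p ∈ Strip (3 + 1) κ, ∑ zx : TorusSite (3 + 1) (Lc ^ m),
        ‖kFibΔM Lc (sfStep Lc) (smStep 3 Lc) m j (Sum.inl κ') (repZ zx) (Sum.inr l) (repZ zy) p‖ ≤
          (5 + 2 * aR 4) * Real.exp (κ * 4) * 5400 * ((Lc : ℝ) ^ m)⁻¹ := by
  obtain ⟨cIn, hcIn, hF4⟩ := GAN24.ArrowInnerShift.exists_cIn 3
  have haR : 0 ≤ aR 4 := le_of_lt (aR_pos 4)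
  have haZ : (0 : ℝ) ≤ 5 / 2 := by norm_num
  obtain ⟨ρ₀, κ₀, hρ₀, hρ, hsmallIn, hκ₀, hκ, hκη, hsmallOut⟩ :=
    exists_radii OmegaOut haZ haR hcIn cOut4_nonneg (by norm_num : (0 : ℝ) < 1 / 2) one_pos OmegaOut_nonneg
  set κ : ℝ := min κ₀ (1 / 4) with hκdef
  have hκpos : 0 < κ := lt_min hκ₀ (by norm_num)
  have hκle : κ ≤ κ₀ := min_le_left _ _
  have hκ4 : κ ≤ 1 / 4 := min_le_right _ _
  have hmono : ∀ p : Fin (3 + 1) → ℂ, p ∈ Strip (3 + 1) κ → p ∈ Strip (3 + 1) κ₀ := fun p hp μ => ⟨(hp μ).1, (hp μ).2.trans hκle⟩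
  have hA5 : 2 * (5 / 2 : ℝ) ≤ 5 + 2 * aR 4 := by linarith
  have hAR : 2 * aR 4 ≤ 5 + 2 * aR 4 := by linarith
  have hA0 : (0 : ℝ) ≤ 5 + 2 * aR 4 := by linarith
  refine ⟨κ, hκpos, hκ4, fun m j zy κ' l => ?_⟩
  -- the four rows of road P1 at the fine blockings `N := Lc^(j+m)` (one-`N` generic, BY NAME)
  have hF3 : ∀ j : ℕ, IsUnit (arrowMat (innerArrow (Lc ^ (j + m)) (0 : Fin (3 + 1) → ℂ))) ∧
      ‖(arrowMat (innerArrow (Lc ^ (j + m)) (0 : Fin (3 + 1) → ℂ)))⁻¹‖ ≤ 5 / 2 := fun j => isUnit_innerArrow_zero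
  have hF4m : ∀ (j : ℕ) (p : Fin (3 + 1) → ℂ) (r : ℝ), (∀ μ, ‖p μ‖ ≤ r) → r ≤ 1 / 2 →
      ‖arrowMat (innerArrow (Lc ^ (j + m)) p) - arrowMat (innerArrow (Lc ^ (j + m)) 0)‖ ≤ cIn * r :=
    fun j p r hp hr => hF4 (Lc ^ (j + m)) p r hp hr
  have hF5m : ∀ (j : ℕ), ∀ q ∈ BZ (3 + 1), q ≠ 0 → IsUnit (arrowMat (outerArrow (Lc ^ (j + m)) q (ofRealVec q))) ∧
      ‖(arrowMat (outerArrow (Lc ^ (j + m)) q (ofRealVec q)))⁻¹‖ ≤ aR 4 :=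
    fun j q hq hq0 => arrowAnchorReal (N := Lc ^ (j + m)) (one_le_pow_add j m) (abs_le_pi_of_mem_BZ hq) hq0
  have hF6m : ∀ (j : ℕ), ∀ q ∈ BZ (3 + 1), q ≠ 0 → ∀ p : Fin (3 + 1) → ℂ, reVec p = q → ∀ η : ℝ, 0 ≤ η → η ≤ 1 → (∀ μ, |(p μ).im| ≤ η) →
      ‖arrowMat (outerArrow (Lc ^ (j + m)) q p) - arrowMat (outerArrow (Lc ^ (j + m)) q (ofRealVec q))‖ ≤ cOut4 * η * omegaOut q := by
    intro j q hq hq0 p hpq η hη0 hη1 him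
    have h := GAN24.ArrowOuterShift.outerLipschitz (D := 4) (N := Lc ^ (j + m)) (one_le_pow_add j m) q hq hq0 p hpq η hη0 hη1 him
    simpa only [cOut4, omegaOut, Nat.cast_ofNat] using h
  have hω : ∀ ρ₀ : ℝ, 0 < ρ₀ → ∀ q ∈ BZ (3 + 1), (∃ μ, ρ₀ / 2 ≤ |q μ|) → omegaOut q ≤ OmegaOut ρ₀ :=
    fun ρ₀ hρ₀ q _ hfar => omegaOut_le hρ₀ q hfar
  -- (U1) at the fine blocking `N = Lc^(j+m)`
  have hU1 : ∀ p ∈ Strip (3 + 1) κ₀, (trigPolySymbol (stencil (3 + 1)) (pieceMatrix (N := Lc ^ (j + m))) p).det ≠ 0 :=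
    det_ne_zero_of_rows (N := Lc ^ (j + m)) omegaOut (hF3 j) (hF4m j) (hF5m j) (hF6m j) (hω ρ₀ hρ₀) haZ haR cOut4_nonneg hρ₀ hρ hsmallIn hκ₀.le hκ
      hκη hsmallOut
  -- (U2) termwise and box-summed, for the column quarter at `(N, M) = (Lc^(j+m), Lc^j)`, box representatives
  have hU2 : ∀ p ∈ Strip (3 + 1) κ,
      (∀ zx : TorusSite (3 + 1) (Lc ^ m), ‖kFibW (Lc ^ (j + m)) (Lc ^ j) (sfStep Lc j) (smStep 3 Lc j) (Sum.inl κ') (repZ zx) (Sum.inr l) (repZ zy) p‖ ≤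
        (5 + 2 * aR 4) * Real.exp (κ * 4) * 5400 * ((Lc : ℝ) ^ m)⁻¹) ∧
      ∑ zx : TorusSite (3 + 1) (Lc ^ m), ‖kFibW (Lc ^ (j + m)) (Lc ^ j) (sfStep Lc j) (smStep 3 Lc j) (Sum.inl κ') (repZ zx) (Sum.inr l) (repZ zy) p‖ ≤
        (5 + 2 * aR 4) * Real.exp (κ * 4) * 5400 * ((Lc : ℝ) ^ m)⁻¹ := by
    intro p hp
    have him : ∀ i, |(p i).im| ≤ κ := fun i => (hp i).2
    have hre : ∀ i, |(p i).re| ≤ π := fun i => (hp i).1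
    rcases apriori_of_rows (N := Lc ^ (j + m)) omegaOut (hF3 j) (hF4m j) (hF5m j) (hF6m j) (hω ρ₀ hρ₀) haZ haR cOut4_nonneg hρ₀ hρ hsmallIn hκ₀.le
        hκ hκη hsmallOut (hmono p hp) with ⟨-, hU, hA⟩ | ⟨-, hq0, hU, hA⟩
    · obtain ⟨hr, -, -⟩ := radI_hyps (N := Lc ^ (j + m))
      exact ⟨fun zx => legBound_jm_fm_of_inv_bound hκpos.le hκ4 hA0 m j him hre (radI (Lc ^ (j + m))) hr one_pos hU (hA.trans hA5) κ' l zx zy,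
        sum_norm_kFibW_jm_fm_le_of_inv_bound hκpos.le hκ4 hA0 m j him (radI (Lc ^ (j + m))) hr one_pos hU (hA.trans hA5) κ' l zy⟩
    · have hq : reVec p ∈ BZ (3 + 1) := reVec_mem_BZ hp
      obtain ⟨hr, -⟩ := radO_hyps (N := Lc ^ (j + m)) hq hq0
      exact ⟨fun zx => legBound_jm_fm_of_inv_bound hκpos.le hκ4 hA0 m j him hre (radO (Lc ^ (j + m)) (reVec p)) hr (hr 0) hU (hA.trans hAR) κ' l zx zy,
        sum_norm_kFibW_jm_fm_le_of_inv_bound hκpos.le hκ4 hA0 m j him (radO (Lc ^ (j + m)) (reVec p)) hr (hr 0) hU (hA.trans hAR) κ' l zy⟩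
  refine ⟨fun zx => ?_, fun p hp => ?_⟩
  · exact stripRegular_kFibΔM hκpos.le _ _ m j (fun p hp => hU1 p (hmono p hp)) (Sum.inl κ') (repZ zx) (Sum.inr l) (repZ zy)
      (fun p hp => by rw [kFibΔM_repZ_eq_kFibW]; exact (hU2 p hp).1 zx)
  · simp only [kFibΔM_repZ_eq_kFibW]
    exact (hU2 p hp).2

end OneStrip

end Summit.QuantumFields.BalabanUV.Beta.FP.PerfectColumnMassFibre

end
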